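import Literature.NumberTheory.EllipticCurves.AnticyclotomicBigGaloisRep
import Mathlib.NumberTheory.Padics.RingHoms
import HarnessLib

/-!
# Twisted-periodic smooth functions `Φ(x + p^t) = F(Φ(x))` in the co-induced model `C^∞(ℤ_p, B)`: they are
# determined by their values at `0, …, p^t − 1`, every value family with finite `p`-power `F`-orbits extends,
# and the cokernel of a commuting `u_*` on them embeds into `(B/uB)^{p^t}` (helper, `--supports stmt-BirchSwinnertonDyer-25505`)

Cell `bsd-stepL`, seat `bsd-stepL-imc-p1` (prover g22, 2026-08-28). Theorems only (no definition, no named fact, no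
`sorry`, no instance, no notation). Step 3 (the structural core, group-free) of the ROADMAP (memo
`HOME/imc-p1/g22/CORNER-25505-imc-p1-g22.md` §7) for the kernel proof of the v4 stub `stub_localDefectFiniteAnomalous` of line
`erratum_chain` of crux 25505 (finiteness of the local control defect `𝓜^{Γ_{K_𝔭̄}}/T_c`).

WHY: by the tree's model isomorphism `BigGaloisRep.exists_linearEquiv_invariantsOf_bigRep` (imc-p1 g13: `M^N ≅ C^∞(ℤ_p, A^N)` for
`κ(N) = 1`, a group element `ψ` acting as the shifted endomorphism `Φ ↦ ρ(ψ)(Φ(· − κψ))`), the invariants of a big representation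
under `N·⟨ψ⟩` with `κψ = p^t` are the TWISTED-PERIODIC functions `Φ(x + p^t) = F(Φ x)`, `F = ρ(ψ)|_{A^N}`, inside `C^∞(ℤ_p, A^N)`;
and by `InvariantsShift.one_add_X_pow_sub_one_smul_apply_of_forall_bigRep_eq` (imc-p1 g22) the `Λ`-element `(1+T)^{p^t} − 1` acts on
them as `u_*` for the VALUE endomorphism `u = ρ(g₁) − 1`. So the local defect `𝓜^G/T_c` of [JSW17, L. 3.4.1] is governed by the
cokernel computed here — twice (outer variable `T_c`, inner variable `T_a`), landing in `(A_g^P/(ρ(g₁) − 1)A_g^P)^{p^{t+f}}`.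

## What is proved (pure algebra: an `𝒪`-module `B`, `F u : B →ₗ[𝒪] B`, `t : ℕ`, `c = p^t ∈ ℤ_p`)

* `eq_of_twisted_of_forall_lt` — UNIQUENESS: two smooth functions with `Φ(x + c) = F(Φ x)` agreeing at `0, …, p^t − 1` are equal
  (induction along `ℕ`, then density of `ℕ` in `ℤ_p` through the level).
* `exists_twisted_of_values` — EXISTENCE: for values `b₀, …, b_{p^t−1}` with `F^{p^m} bᵢ = bᵢ` and `p^k bᵢ = 0` there is a smooth
  `p`-primary `Φ` with `Φ(x + c) = F(Φ x)` and `Φ(i) = bᵢ` — `Φ(x) = F^{q(x)} b_{r(x)}` for `x ≡ q(x)p^t + r(x) (mod p^{t+m})`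
  (`PadicInt.toZModPow`), the wrap-around absorbed by `F^{p^m} bᵢ = bᵢ`.
* `finite_twisted_quot_mapRange` — COKERNEL: if every `b ∈ B` has a finite `p`-power `F`-orbit and is `p`-power torsion, `u` commutes with
  `F`, and `B/uB` is finite, then on `K = {Φ : Φ(· + c) = F_* Φ}` (`= ker(τ_c − F_*)`) the quotient `K/u_*K` is finite (it embeds into
  `(B/uB)^{p^t}` by evaluation at `0, …, p^t − 1`).

HONEST FRAMING: module bookkeeping; nothing about any newform or curve; BSD is proved for no pair; closes: none (T7).

## References
* [JetchevSkinnerWan2017] §3.4, Lemma 3.4.1 (arXiv:1512.06894 p. 14). [SkinnerUrban2014] §3.1.3 (the co-induced model). [GreenbergVatsal2000] Prop. 2.4.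
-/

noncomputable section

open PowerSeries Literature.NumberTheory.EllipticCurves Literature.NumberTheory.EllipticCurves.BigRepModule
open scoped Pointwise

-- D-0017: single-problem summit, the namespace repeats the problem name by design.
set_option linter.dupNamespace false
set_option autoImplicit false

namespace Summit.BirchSwinnertonDyer.BirchSwinnertonDyer.Theorems.ErratumThm23TwoVariable.TwistedPeriodic

variable {𝒪 : Type*} [CommRing 𝒪] {p : ℕ} [Fact p.Prime] {B : Type*} [AddCommGroup B] [Module 𝒪 B]

/-! ## §0 Small tools -/

/-- Translation commutes with post-composition. [folklore] -/
theorem translate_mapRange (c : ℤ_[p]) (L : B →ₗ[𝒪] B) (Φ : BigRepModule 𝒪 p B) :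
    translate c (mapRange L Φ) = mapRange L (translate c Φ) := by
  ext x; rfl

omit [Fact p.Prime] in
/-- `F^i b = F^j b` when `F^{p^m} b = b` and `i ≡ j (mod p^m)`. [folklore] -/
theorem pow_apply_eq_of_modEq (F : B →ₗ[𝒪] B) {m : ℕ} {b : B} (hb : (F ^ p ^ m) b = b) {i j : ℕ}
    (h : i ≡ j [MOD p ^ m]) : (F ^ i) b = (F ^ j) b := by
  have key : ∀ i : ℕ, (F ^ i) b = (F ^ (i % p ^ m)) b := by
    intro i
    conv_lhs => rw [← Nat.mod_add_div i (p ^ m), pow_add, pow_mul]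
    rw [Module.End.mul_apply]
    congr 1
    induction i / p ^ m with
    | zero => rw [pow_zero, Module.End.one_apply]
    | succ n ih => rw [pow_succ, Module.End.mul_apply, hb, ih]
  rw [key i, key j, h]

/-- The canonical representative `a_n(x) ∈ [0, p^n)` of `x mod p^n` (`(toZModPow n x).val`) is congruent to `x`.
[folklore] -/
theorem sub_val_toZModPow_mem (n : ℕ) (x : ℤ_[p]) :
    x - ((PadicInt.toZModPow n x).val : ℤ_[p]) ∈ Ideal.span {(p : ℤ_[p]) ^ n} := by
  rw [← PadicInt.ker_toZModPow, RingHom.mem_ker, map_sub, map_natCast, ZMod.natCast_zmod_val, sub_self]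

/-- The representative depends only on `x mod p^n`. [folklore] -/
theorem val_toZModPow_eq_of_sub_mem {n : ℕ} {x y : ℤ_[p]} (h : x - y ∈ Ideal.span {(p : ℤ_[p]) ^ n}) :
    (PadicInt.toZModPow n x).val = (PadicInt.toZModPow n y).val := by
  rw [← PadicInt.ker_toZModPow, RingHom.mem_ker, map_sub, sub_eq_zero] at h
  rw [h]

/-- The representative of `x + c` for a natural `c` is `≡ a_n(x) + c (mod p^n)`. [folklore] -/
theorem val_toZModPow_add_natCast_modEq (n : ℕ) (x : ℤ_[p]) (c : ℕ) :
    (PadicInt.toZModPow n (x + (c : ℤ_[p]))).val ≡ (PadicInt.toZModPow n x).val + c [MOD p ^ n] := by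
  rw [← ZMod.natCast_eq_natCast_iff, Nat.cast_add, ZMod.natCast_zmod_val, map_add, map_natCast,
    ZMod.natCast_zmod_val]

/-- The representative of a small natural number is itself. [folklore] -/
theorem val_toZModPow_natCast_of_lt {n i : ℕ} (hi : i < p ^ n) :
    (PadicInt.toZModPow n (i : ℤ_[p])).val = i := by
  rw [map_natCast, ZMod.val_natCast_of_lt hi]

/-- A smooth function is determined by its values on `ℕ` (every class mod `p^n` contains its representative). [folklore] -/
theorem eq_zero_of_forall_natCast (Φ : BigRepModule 𝒪 p B) (h : ∀ i : ℕ, Φ (i : ℤ_[p]) = 0) : Φ = 0 := by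
  obtain ⟨n, hn⟩ := Φ.exists_level
  ext x
  rw [hn x ((PadicInt.toZModPow n x).val : ℤ_[p]) (sub_val_toZModPow_mem n x), h, BigRepModule.zero_apply]

/-! ## §1 Uniqueness -/

/-- **A twisted-periodic smooth function (`Φ(x + p^t) = F(Φ x)`) vanishing at `0, …, p^t − 1` vanishes.** [folklore] -/
theorem eq_zero_of_twisted_of_forall_lt (F : B →ₗ[𝒪] B) (t : ℕ) {Φ : BigRepModule 𝒪 p B}
    (hΦ : translate ((p : ℤ_[p]) ^ t) Φ = mapRange F Φ) (h0 : ∀ i : ℕ, i < p ^ t → Φ (i : ℤ_[p]) = 0) :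
    Φ = 0 := by
  have hstep : ∀ x : ℤ_[p], Φ (x + (p : ℤ_[p]) ^ t) = F (Φ x) := fun x ↦ by
    have h := DFunLike.congr_fun hΦ x
    rw [translate_apply, mapRange_apply] at h
    exact h
  refine eq_zero_of_forall_natCast Φ fun i ↦ ?_
  induction i using Nat.strong_induction_on with
  | _ i ih =>
    by_cases hi : i < p ^ t
    · exact h0 i hi
    · obtain ⟨j, rfl⟩ := Nat.exists_eq_add_of_le (not_lt.1 hi)
      have hpos : 0 < p ^ t := Nat.pow_pos (Fact.out : p.Prime).pos
      rw [Nat.cast_add, Nat.cast_pow, add_comm, hstep, ih j (by omega), map_zero]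

/-- **Uniqueness**: two twisted-periodic smooth functions with the same values at `0, …, p^t − 1` are equal. [folklore] -/
theorem eq_of_twisted_of_forall_lt (F : B →ₗ[𝒪] B) (t : ℕ) {Φ Ψ : BigRepModule 𝒪 p B}
    (hΦ : translate ((p : ℤ_[p]) ^ t) Φ = mapRange F Φ) (hΨ : translate ((p : ℤ_[p]) ^ t) Ψ = mapRange F Ψ)
    (h : ∀ i : ℕ, i < p ^ t → Φ (i : ℤ_[p]) = Ψ (i : ℤ_[p])) : Φ = Ψ := by
  rw [← sub_eq_zero]
  refine eq_zero_of_twisted_of_forall_lt F t (by rw [map_sub, map_sub, hΦ, hΨ]) fun i hi ↦ ?_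
  rw [BigRepModule.sub_apply, h i hi, sub_self]

/-! ## §2 Existence: extending values at `0, …, p^t − 1` -/

/-- **Existence**: values `b₀, …, b_{p^t−1}` (indexed by `ℕ`, only `i < p^t` used) with `F^{p^m} bᵢ = bᵢ` and `p^k • bᵢ = 0` extend
to a smooth `p`-primary twisted-periodic function: `Φ(x) = F^{q} b_{r}` for `a_{t+m}(x) = q p^t + r`, `r < p^t`. [folklore] -/
theorem exists_twisted_of_values (F : B →ₗ[𝒪] B) (t m k : ℕ) (b : ℕ → B)
    (hF : ∀ i, (F ^ p ^ m) (b i) = b i) (hk : ∀ i, p ^ k • b i = 0) :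
    ∃ Φ : BigRepModule 𝒪 p B, translate ((p : ℤ_[p]) ^ t) Φ = mapRange F Φ ∧
      ∀ i : ℕ, i < p ^ t → Φ (i : ℤ_[p]) = b i := by
  classical
  have hpt : 0 < p ^ t := Nat.pow_pos (Fact.out : p.Prime).pos
  -- the representative `a(x) ∈ [0, p^{t+m})` and the function `x ↦ F^{a(x)/p^t} b_{a(x) % p^t}`
  let a : ℤ_[p] → ℕ := fun x ↦ (PadicInt.toZModPow (t + m) x).val
  have ha : ∀ x, a x = (PadicInt.toZModPow (t + m) x).val := fun _ ↦ rfl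
  let f : ℤ_[p] → B := fun x ↦ (F ^ (a x / p ^ t)) (b (a x % p ^ t))
  have hfx : ∀ x, f x = (F ^ (a x / p ^ t)) (b (a x % p ^ t)) := fun _ ↦ rfl
  have hf : f ∈ bigRepSubmodule 𝒪 p B := by
    refine ⟨⟨t + m, fun x y hxy ↦ ?_⟩, ⟨k, fun x ↦ ?_⟩⟩
    · rw [hfx, hfx, ha, ha, val_toZModPow_eq_of_sub_mem hxy]
    · rw [hfx, ← map_nsmul, hk, map_zero]
  refine ⟨BigRepModule.mk f hf, ?_, fun i hi ↦ ?_⟩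
  · -- twisted periodicity: `a(x + p^t) ≡ a(x) + p^t (mod p^{t+m})` gives the same `r` and `q ↦ q + 1 (mod p^m)`
    ext x
    rw [translate_apply, mapRange_apply, BigRepModule.mk_apply, BigRepModule.mk_apply, hfx, hfx]
    have hmod : a (x + (p : ℤ_[p]) ^ t) ≡ a x + p ^ t [MOD p ^ (t + m)] := by
      have h := val_toZModPow_add_natCast_modEq (t + m) x (p ^ t)
      rwa [Nat.cast_pow] at h
    -- decompose
    set q := a x / p ^ t with hq
    set r := a x % p ^ t with hr
    set q' := a (x + (p : ℤ_[p]) ^ t) / p ^ t with hq'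
    set r' := a (x + (p : ℤ_[p]) ^ t) % p ^ t with hr'
    have hax : a x = r + p ^ t * q := by rw [hr, hq, Nat.mod_add_div]
    have hax' : a (x + (p : ℤ_[p]) ^ t) = r' + p ^ t * q' := by rw [hr', hq', Nat.mod_add_div]
    -- same remainder mod `p^t`
    have hmodt : a (x + (p : ℤ_[p]) ^ t) ≡ a x + p ^ t [MOD p ^ t] :=
      hmod.of_dvd (pow_dvd_pow p (Nat.le_add_right t m))
    have hrr : r' = r := by
      have h1 : a (x + (p : ℤ_[p]) ^ t) ≡ a x [MOD p ^ t] := by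
        have h2 : a x + p ^ t ≡ a x [MOD p ^ t] := by
          simp [Nat.ModEq, Nat.add_mod_right]
        exact hmodt.trans h2
      exact h1
    -- quotients congruent mod `p^m`
    have hqq : q' ≡ q + 1 [MOD p ^ m] := by
      have h2 : a x + p ^ t = r + p ^ t * (q + 1) := by rw [hax]; ring
      have h1 : r + p ^ t * q' ≡ r + p ^ t * (q + 1) [MOD p ^ (t + m)] := by
        have h1' : r' + p ^ t * q' ≡ r + p ^ t * (q + 1) [MOD p ^ (t + m)] := by
          rw [← hax', ← h2]; exact hmod
        rwa [hrr] at h1'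
      have h3 : p ^ t * q' ≡ p ^ t * (q + 1) [MOD p ^ t * p ^ m] := by
        rw [← pow_add]
        exact Nat.ModEq.add_left_cancel' r h1
      exact Nat.ModEq.mul_left_cancel' hpt.ne' h3
    change (F ^ q') (b r') = F ((F ^ q) (b r))
    rw [hrr, pow_apply_eq_of_modEq F (hF r) hqq, pow_succ', Module.End.mul_apply]
  · -- values at `i < p^t`
    rw [BigRepModule.mk_apply, hfx]
    have hai : a (i : ℤ_[p]) = i :=
      val_toZModPow_natCast_of_lt (lt_of_lt_of_le hi (Nat.pow_le_pow_right (Fact.out : p.Prime).pos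
        (Nat.le_add_right t m)))
    rw [hai, Nat.div_eq_of_lt hi, Nat.mod_eq_of_lt hi, pow_zero, Module.End.one_apply]

/-! ## §3 The cokernel of a commuting `u_*` on twisted-periodic functions -/

/-- `u_*` preserves the twisted-periodic functions when `u` commutes with `F`. [folklore] -/
theorem mapRange_mem_ker_of_mem_ker (F u : B →ₗ[𝒪] B) (hcomm : ∀ b, u (F b) = F (u b)) (t : ℕ)
    {Φ : BigRepModule 𝒪 p B} (hΦ : translate ((p : ℤ_[p]) ^ t) Φ = mapRange F Φ) :
    translate ((p : ℤ_[p]) ^ t) (mapRange u Φ) = mapRange F (mapRange u Φ) := by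
  rw [translate_mapRange, hΦ]
  ext x
  simp only [mapRange_apply, hcomm]

/-- **The cokernel of `u_*` on the twisted-periodic functions embeds into `(B/uB)^{p^t}`**, hence is finite when `B/uB` is:
for `B` with finite `p`-power `F`-orbits and `p`-power torsion, `u` commuting with `F`, and
`K = ker(τ_{p^t} − F_*) ⊆ C^∞(ℤ_p, B)`, the quotient of `K` by `u_* K` is finite. (With `B = A_g^{P}`, `F = ρ(g₂)`, `u = ρ(g₁) − 1` this is
the local control defect of [JSW17, Lemma 3.4.1] at one level of the two-variable tower.)
[cite: JetchevSkinnerWan2017, §3.4, Lemma 3.4.1 (arXiv:1512.06894 p. 14)] -/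
theorem finite_twisted_quot_mapRange (F u : B →ₗ[𝒪] B) (hcomm : ∀ b, u (F b) = F (u b)) (t : ℕ)
    (hF : ∀ b : B, ∃ m : ℕ, (F ^ p ^ m) b = b) (hk : ∀ b : B, ∃ k : ℕ, p ^ k • b = 0)
    [hfin : Finite (B ⧸ LinearMap.range u)] :
    Finite (↥(LinearMap.ker (translate ((p : ℤ_[p]) ^ t) - mapRange F : BigRepModule 𝒪 p B →ₗ[𝒪] BigRepModule 𝒪 p B)) ⧸
      Submodule.comap (LinearMap.ker (translate ((p : ℤ_[p]) ^ t) - mapRange F :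
          BigRepModule 𝒪 p B →ₗ[𝒪] BigRepModule 𝒪 p B)).subtype
        (Submodule.map (mapRange u) (LinearMap.ker (translate ((p : ℤ_[p]) ^ t) - mapRange F :
          BigRepModule 𝒪 p B →ₗ[𝒪] BigRepModule 𝒪 p B)))) := by
  classical
  set K : Submodule 𝒪 (BigRepModule 𝒪 p B) :=
    LinearMap.ker (translate ((p : ℤ_[p]) ^ t) - mapRange F : BigRepModule 𝒪 p B →ₗ[𝒪] BigRepModule 𝒪 p B) with hK
  set I : Submodule 𝒪 ↥K := Submodule.comap K.subtype (Submodule.map (mapRange u) K) with hI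
  have hmemK : ∀ Φ : BigRepModule 𝒪 p B, Φ ∈ K ↔ translate ((p : ℤ_[p]) ^ t) Φ = mapRange F Φ := fun Φ ↦ by
    rw [hK, LinearMap.mem_ker, LinearMap.sub_apply, sub_eq_zero]
  -- evaluation at `0, …, p^t − 1` modulo `uB`
  let ev : ↥K → (Fin (p ^ t) → B ⧸ LinearMap.range u) := fun Φ i ↦
    Submodule.Quotient.mk ((Φ : BigRepModule 𝒪 p B) ((i : ℕ) : ℤ_[p]))
  -- two functions with the same evaluation differ by `u_*` of a twisted-periodic function
  have hev : ∀ Φ Ψ : ↥K, ev Φ = ev Ψ → Φ - Ψ ∈ I := by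
    intro Φ Ψ h
    -- preimages of the values of `Φ − Ψ` under `u`
    have hval : ∀ i : Fin (p ^ t), ∃ b : B,
        u b = (Φ : BigRepModule 𝒪 p B) ((i : ℕ) : ℤ_[p]) - (Ψ : BigRepModule 𝒪 p B) ((i : ℕ) : ℤ_[p]) := by
      intro i
      have hi := congrFun h i
      change Submodule.Quotient.mk _ = Submodule.Quotient.mk _ at hi
      rw [Submodule.Quotient.eq, LinearMap.mem_range] at hi
      exact hi
    choose b hb using hval
    -- a uniform orbit exponent and torsion exponent for the finitely many `b i`
    choose m hm using fun i : Fin (p ^ t) ↦ hF (b i)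
    choose k hk' using fun i : Fin (p ^ t) ↦ hk (b i)
    let b' : ℕ → B := fun i ↦ if hi : i < p ^ t then b ⟨i, hi⟩ else 0
    set M := Finset.univ.sup m with hM
    set Kx := Finset.univ.sup k with hKx
    have hFb' : ∀ i, (F ^ p ^ M) (b' i) = b' i := by
      intro i
      by_cases hi : i < p ^ t
      · have hle : m ⟨i, hi⟩ ≤ M := Finset.le_sup (f := m) (Finset.mem_univ _)
        have hdvd : p ^ m ⟨i, hi⟩ ∣ p ^ M := pow_dvd_pow p hle
        have h := pow_apply_eq_of_modEq F (hm ⟨i, hi⟩) (Nat.modEq_zero_iff_dvd.2 hdvd)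
        rw [pow_zero, Module.End.one_apply] at h
        simpa only [b', dif_pos hi] using h
      · simp only [b', dif_neg hi, map_zero]
    have hkb' : ∀ i, p ^ Kx • b' i = 0 := by
      intro i
      by_cases hi : i < p ^ t
      · simp only [b', dif_pos hi]
        have hle : k ⟨i, hi⟩ ≤ Kx := Finset.le_sup (f := k) (Finset.mem_univ _)
        obtain ⟨d, hd⟩ := Nat.exists_eq_add_of_le hle
        rw [hd, pow_add, mul_comm, mul_smul, hk', smul_zero]
      · simp only [b', dif_neg hi, smul_zero]
    obtain ⟨Θ, hΘ, hΘval⟩ := exists_twisted_of_values F t M Kx b' hFb' hkb'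
    have hΘK : Θ ∈ K := (hmemK Θ).2 hΘ
    have huΘK : mapRange u Θ ∈ K := (hmemK _).2 (mapRange_mem_ker_of_mem_ker F u hcomm t hΘ)
    -- `u_* Θ = Φ − Ψ` by uniqueness
    have heq : mapRange u Θ = (Φ : BigRepModule 𝒪 p B) - (Ψ : BigRepModule 𝒪 p B) := by
      refine eq_of_twisted_of_forall_lt F t (mapRange_mem_ker_of_mem_ker F u hcomm t hΘ)
        (by rw [map_sub, map_sub, (hmemK _).1 Φ.2, (hmemK _).1 Ψ.2]) fun i hi ↦ ?_
      rw [mapRange_apply, hΘval i hi, BigRepModule.sub_apply]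
      simp only [b', dif_pos hi]
      exact hb ⟨i, hi⟩
    rw [hI, Submodule.mem_comap, Submodule.subtype_apply, Submodule.mem_map]
    exact ⟨Θ, hΘK, by rw [heq]; rfl⟩
  -- conclude by injectivity into a finite type
  haveI : Finite (Fin (p ^ t) → B ⧸ LinearMap.range u) := Pi.finite
  refine Finite.of_injective (fun q : ↥K ⧸ I ↦ ev q.out) fun q₁ q₂ h ↦ ?_
  have e : (Submodule.Quotient.mk q₁.out : ↥K ⧸ I) = Submodule.Quotient.mk q₂.out :=
    (Submodule.Quotient.eq I).2 (hev _ _ h)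
  have h₁ : (Submodule.Quotient.mk q₁.out : ↥K ⧸ I) = q₁ := Quotient.out_eq q₁
  have h₂ : (Submodule.Quotient.mk q₂.out : ↥K ⧸ I) = q₂ := Quotient.out_eq q₂
  rw [h₁, h₂] at e
  exact e

end Summit.BirchSwinnertonDyer.BirchSwinnertonDyer.Theorems.ErratumThm23TwoVariable.TwistedPeriodic

end
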